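import Summits.BirchSwinnertonDyer.BirchSwinnertonDyer.Theorems.SignedLowerHalvesSmallImageLowerHalfBothSignsRttCharRoadE2JunctionFinite
import Summits.BirchSwinnertonDyer.BirchSwinnertonDyer.Theorems.SignedLowerHalvesSmallImageLowerHalfBothSignsRttCharRoadE2JunctionMonotone
import HarnessLib

/-!
# Route `SignedLowerHalves`, crux L `SmallImageLowerHalfBothSigns` (stmt-BirchSwinnertonDyer-23599), line `rtt_w3` v14 → v15 — E2, junction row J2:
# THE J2 SOCKET — `B ⧸ range s` is finitely generated torsion with `λ ≤ λ(H2[f])` as soon as the specialisation sequence `Hsp —s→ B —δ₁→ H2[f]` is exact at `B`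

WHY (LEAD `cruxlead-stmt-BirchSwinnertonDyer-23599` g11; BRIEF-E2 rev 5.2 §3 row J2). The consumers (p780454 …, depleted p784031 … p784278) take three J2 hypotheses:
`[Module.Finite Λ (B ⧸ range s)]` (now `[Module.Finite Λ B]`, reduced to the former by p784717), `htB : IsTorsion Λ (B ⧸ range s)` and
`hcoker : λ(B ⧸ range s) ≤ λ(H2[f])`. In E2 all three come from ONE Galois-cohomological fact: the long exact specialisation sequence
`𝐇¹₂ —f→ 𝐇¹₂ —sp¹→ 𝐇¹_Iw(K_∞, T*) —δ→ 𝐇²₂ —f→ 𝐇²₂`, i.e. `coker sp¹ ↪ 𝐇²₂[f]`. ★★★ `junction_coker_of_exact₂`: from an additive `δ₁ : B → H2[f]`,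
`Λ_𝒪`-semilinear along `ι = PowerSeries.map C` (`δ₁ (l • x) = (ι l) • δ₁ x`), with `δ₁ x = 0 ↔ x ∈ range s`, and the road-D frame facts already in the consumers
(`H2` f.g. torsion over `R`, `f`-regular: `¬ char_R(H2) ≤ (f)` — derived there from `hdef` + `Thm52Shape`, p782187), the pinned `Λ`-structure `hΛT` on `H2[f]`:
`Module.Finite Λ (B ⧸ range s) ∧ IsTorsion Λ (B ⧸ range s) ∧ λ(B ⧸ range s) ≤ λ(H2[f])`. So row J2's research deliverable is exactly `(s, δ₁, hδ₁, hex₁)`.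

THEOREMS ONLY (`--supports stmt-BirchSwinnertonDyer-23599` helper); closes nothing; crux L, crux M, E2 and BSD remain OPEN and are proved for NO curve by any of this.
[cite: JohnsonLeungKings2011, §4.2, Lemma 4.4, Thm. 5.2] [cite: Washington1997, §13.2] [cite: BourbakiAC5to7, VII §4.5]
-/

set_option autoImplicit false
-- the Theorems namespace of this sub repeats the summit name by design (D-0017 nested layout)
set_option linter.dupNamespace false

noncomputable section
open scoped Pointwise

open PowerSeries Literature.NumberTheory.Automorphic Literature.NumberTheory.EllipticCurves Literature.NumberTheory.EllipticCurves.Module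
  Literature.NumberTheory.EllipticCurves.IwasawaDual
open Literature.NumberTheory.ComplexMultiplication.EllipticUnits.JohnsonLeungKings2011
open Summit.BirchSwinnertonDyer.BirchSwinnertonDyer.Theorems.SmallImageRttD2LamSpec
open Summit.BirchSwinnertonDyer.BirchSwinnertonDyer.Theorems.SignedBaseChangeAcDivSpecialization.LocalLength (isPrincipal_charIdeal_of_ufm)
open Literature.NumberTheory.IwasawaTheory

namespace Summit.BirchSwinnertonDyer.BirchSwinnertonDyer.Theorems.SmallImageRttCharRoad

universe v w w'

section J2

variable {p : ℕ} [Fact p.Prime] {S : Set (PadicAlgCl p)} [FiniteDimensional ℚ_[p] (padicCoeffField S)]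

set_option maxHeartbeats 400000 in -- pinned module binders: instance unification in the `Λ_𝒪`-reading is slow (same budget line as p776030's readers)
/-- ★★★ **The J2 socket.** See the module docstring. [cite: JohnsonLeungKings2011, §4.2, Lemma 4.4] [cite: Washington1997, §13.2] [cite: BourbakiAC5to7, VII §4.5] -/
theorem junction_coker_of_exact₂ {H2 : Type v} [AddCommGroup H2] [Module (PowerSeries (IwasawaAlgebraO S)) H2]
    [Module.Finite (PowerSeries (IwasawaAlgebraO S)) H2]
    (b : padicCoeffIntegers S) (φ : PowerSeries (IwasawaAlgebraO S) →+* IwasawaAlgebraO S)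
    (hφf : φ (C (X - C b)) = 0) (hC : ∀ a : padicCoeffIntegers S, φ (C (C a)) = C a) (hX : φ X = X)
    (hker : RingHom.ker φ = Ideal.span {C (X - C b)})
    (htors : Module.IsTorsion (PowerSeries (IwasawaAlgebraO S)) H2)
    (hreg : ¬ charIdeal (PowerSeries (IwasawaAlgebraO S)) H2 ≤ Ideal.span {(C (X - C b) : PowerSeries (IwasawaAlgebraO S))})
    [Algebra (IwasawaAlgebra p) (IwasawaAlgebraO S)]
    (halg : ∀ r : IwasawaAlgebra p, algebraMap (IwasawaAlgebra p) (IwasawaAlgebraO S) r = iwasawaToIwasawaO S r)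
    [Module (IwasawaAlgebra p) (Submodule.torsionBy (PowerSeries (IwasawaAlgebraO S)) H2 (C (X - C b)))]
    (hΛT : ∀ (r : IwasawaAlgebra p) (x : Submodule.torsionBy (PowerSeries (IwasawaAlgebraO S)) H2 (C (X - C b))),
      r • x = (PowerSeries.map (PowerSeries.C : padicCoeffIntegers S →+* IwasawaAlgebraO S) (iwasawaToIwasawaO S r)) • x)
    {Hsp : Type w'} [AddCommGroup Hsp] [Module (IwasawaAlgebraO S) Hsp]
    {B : Type w} [AddCommGroup B] [Module (IwasawaAlgebraO S) B] [Module (IwasawaAlgebra p) B] [IsScalarTower (IwasawaAlgebra p) (IwasawaAlgebraO S) B]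
    (s : Hsp →ₗ[IwasawaAlgebraO S] B) (δ₁ : B →+ Submodule.torsionBy (PowerSeries (IwasawaAlgebraO S)) H2 (C (X - C b)))
    (hδ₁ : ∀ (l : IwasawaAlgebraO S) (x : B), δ₁ (l • x) = (PowerSeries.map (PowerSeries.C : padicCoeffIntegers S →+* IwasawaAlgebraO S) l) • δ₁ x)
    (hex₁ : ∀ x : B, δ₁ x = 0 ↔ x ∈ LinearMap.range s) :
    Module.Finite (IwasawaAlgebra p) (B ⧸ LinearMap.range s) ∧ Module.IsTorsion (IwasawaAlgebra p) (B ⧸ LinearMap.range s) ∧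
      lambdaInvariant p (B ⧸ LinearMap.range s) ≤ lambdaInvariant p (Submodule.torsionBy (PowerSeries (IwasawaAlgebraO S)) H2 (C (X - C b))) := by
  -- `𝒪` is a DVR, `R` factorial
  haveI : IsDiscreteValuationRing (padicCoeffIntegers S) := by
    rw [padicCoeffIntegers_eq_unitBall S]; exact LambdaLowerBoundO.isDiscreteValuationRing_unitBall p _
  haveI : UniqueFactorizationMonoid (PowerSeries (IwasawaAlgebraO S)) := uniqueFactorizationMonoid_powerSeries_powerSeries (padicCoeffIntegers S)
  -- the `Λ_𝒪`-structure on `H2` (hence on `H2[f]`) by restriction along `ι`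
  letI : Algebra (IwasawaAlgebraO S) (PowerSeries (IwasawaAlgebraO S)) :=
    (PowerSeries.map (PowerSeries.C : padicCoeffIntegers S →+* IwasawaAlgebraO S)).toAlgebra
  letI i2 : Module (IwasawaAlgebraO S) H2 := Module.compHom H2 (PowerSeries.map (PowerSeries.C : padicCoeffIntegers S →+* IwasawaAlgebraO S))
  haveI : IsScalarTower (IwasawaAlgebraO S) (PowerSeries (IwasawaAlgebraO S)) H2 := IsScalarTower.of_algebraMap_smul fun _ _ ↦ rfl
  -- f.g. torsion of `H2[f]` over `Λ_𝒪` (p775349 pattern, as in p776030)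
  obtain ⟨tB, htB, htB0⟩ := Submodule.annihilator_top_inter_nonZeroDivisors htors
  have htB' : ∀ m : H2, tB • m = 0 := fun m ↦ Submodule.mem_annihilator.mp htB m Submodule.mem_top
  obtain ⟨g, hg⟩ := (isPrincipal_charIdeal_of_ufm (R := PowerSeries (IwasawaAlgebraO S)) (M := H2)).principal
  have hgB : charIdeal (PowerSeries (IwasawaAlgebraO S)) H2 = Ideal.span {g} := hg
  have hg0 : φ g ≠ 0 := by
    intro h0
    apply hreg
    rw [hgB, Ideal.span_singleton_le_iff_mem, ← hker]
    exact h0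
  obtain ⟨-, -, hfinTB, htorTB⟩ := finite_isTorsion_quotSMulTop_torsionBy_of_innerEval b φ hφf hC hX hker H2
    (nonZeroDivisors.ne_zero htB0) htB' hgB hg0
  -- the glue's `Λ`-tower on `H2[f]` from the pin
  haveI : IsScalarTower (IwasawaAlgebra p) (IwasawaAlgebraO S) (Submodule.torsionBy (PowerSeries (IwasawaAlgebraO S)) H2 (C (X - C b))) :=
    IsScalarTower.of_algebraMap_smul fun r x ↦ by
      rw [hΛT r x, halg]
      exact (IsScalarTower.algebraMap_smul (PowerSeries (IwasawaAlgebraO S)) (iwasawaToIwasawaO S r) x).symm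
  haveI : Module.Finite (IwasawaAlgebra p) (Submodule.torsionBy (PowerSeries (IwasawaAlgebraO S)) H2 (C (X - C b))) :=
    moduleFinite_of_moduleFinite_iwasawaAlgebraO p S halg _
  have htorT : Module.IsTorsion (IwasawaAlgebra p) (Submodule.torsionBy (PowerSeries (IwasawaAlgebraO S)) H2 (C (X - C b))) :=
    isTorsion_of_isTorsion_iwasawaAlgebraO p S halg _ htorTB
  -- `δ₁` is `Λ`-linear for the tower structure on `B` and the pinned structure on `H2[f]`
  let δΛ : B →ₗ[IwasawaAlgebra p] Submodule.torsionBy (PowerSeries (IwasawaAlgebraO S)) H2 (C (X - C b)) :=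
    { toFun := δ₁, map_add' := δ₁.map_add, map_smul' := fun r x ↦ by
        rw [RingHom.id_apply, ← IsScalarTower.algebraMap_smul (IwasawaAlgebraO S) r x, halg, hδ₁, hΛT r (δ₁ x)] }
  have hkerδ : LinearMap.ker δΛ = (LinearMap.range s).restrictScalars (IwasawaAlgebra p) := by
    ext x
    rw [LinearMap.mem_ker, Submodule.restrictScalars_mem]
    exact hex₁ x
  -- the induced injection `B ⧸ range s ↪ H2[f]`
  let e : (B ⧸ (LinearMap.range s).restrictScalars (IwasawaAlgebra p)) →ₗ[IwasawaAlgebra p]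
      Submodule.torsionBy (PowerSeries (IwasawaAlgebraO S)) H2 (C (X - C b)) :=
    ((LinearMap.range s).restrictScalars (IwasawaAlgebra p)).liftQ δΛ hkerδ.ge
  have he : Function.Injective e := by
    rw [← LinearMap.ker_eq_bot]
    exact Submodule.ker_liftQ_eq_bot _ _ _ hkerδ.le
  let q : (B ⧸ (LinearMap.range s).restrictScalars (IwasawaAlgebra p)) ≃ₗ[IwasawaAlgebra p] (B ⧸ LinearMap.range s) :=
    Submodule.Quotient.restrictScalarsEquiv (IwasawaAlgebra p) (LinearMap.range s)
  let e' : (B ⧸ LinearMap.range s) →ₗ[IwasawaAlgebra p] Submodule.torsionBy (PowerSeries (IwasawaAlgebraO S)) H2 (C (X - C b)) :=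
    e ∘ₗ q.symm.toLinearMap
  have he' : Function.Injective e' := he.comp q.symm.injective
  refine ⟨Module.Finite.of_injective e' he', fun x ↦ ?_, lambdaInvariant_le_of_injective_of_isTorsion e' he' htorT⟩
  obtain ⟨a, ha⟩ := @htorT (e' x)
  refine ⟨a, he' ?_⟩
  change e' (a • x) = e' 0
  rw [map_zero, LinearMap.map_smul_of_tower]
  exact ha

end J2

end Summit.BirchSwinnertonDyer.BirchSwinnertonDyer.Theorems.SmallImageRttCharRoad

end
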